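import Mathlib
import HarnessLib
import Summits.Ventures.LatticeQCDFlow.Scoring.KArmHomogeneityCoverage
import Summits.Ventures.LatticeQCDFlow.Scoring.GaussianCochranIndependence

/-!
# POOLING `k` IMPLEMENTATIONS: THE INVERSE-VARIANCE POOLED ESTIMATE AND THE HOMOGENEITY STATISTIC
# CONVERGE JOINTLY; THE POOLED INTERVAL IS CALIBRATED AND NEVER WIDER THAN THE BEST SINGLE CODE'S

HONEST FRAMING: exact (Metropolis-corrected) sampling algorithms for lattice gauge theory;
figures of merit are autocorrelation/cost numbers at stated couplings and volumes; no
continuum-physics claim.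

Venture `LatticeQCDFlow` (cell pub-lqcd), topic `Scoring`; FANOUT row 4 (`s0-u1-b`, GEN-35).
NEW WORK of the cell (classical large-sample statistics; our formalisation), no definition,
nothing cited as a fact (inverse-variance / fixed-effect pooling and Cochran's `Q` are NAMED ONLY).

WHY (row 4).  Once `R ≥ 2` implementations of one sampler agree (the one-shot homogeneity test of
`Scoring/KArmHomogeneityCoverage` passes), the figure of merit one quotes is the POOLED estimate
`m̂ₖ = (Σ_r Sₖ^r/V̂ₖ^r)/(Σ_r 1/V̂ₖ^r)` with squared error bar `V̂ₖ^pool = (Σ_r 1/V̂ₖ^r)⁻¹`.  In the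
setting of that file (code `r` prints `Sₖ^r`, `V̂ₖ^r` on its own probability space,
`√k(Sₖ^r − a) ⇒ Z_r` independent limits, `k·V̂ₖ^r → s_r > 0` a.s.) this file proves:
(i) the PAIR (studentised pooled deviation², homogeneity statistic)
`(((m̂ₖ − a)²/V̂ₖ^pool, Qₖ))` converges in distribution to the pair of Gaussian functionals
`((Σ_r Z_r/s_r)²/(Σ_r s_r⁻¹), Σ_r (Z_r − m̂(Z))²/s_r)` (**`kArm_pooled_homogeneity_joint_tendsto`**,
any independent limits — Slutsky with the clamped functionals, eventual almost-sure agreement);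
(ii) hence `P((m̂ₖ − a)² ≤ z²·V̂ₖ^pool) → P'((Σ_r Z_r/s_r)²/(Σ_r s_r⁻¹) ≤ z²)` whenever the limit has
no atom at `z²` (**`kArm_pooled_limit`**), and for Gaussian limits `Z_r ∼ N(0, s_r)` (equal targets)
**`kArm_pooled_coverage`**: `P(|m̂ₖ − a| ≤ z·√V̂ₖ^pool) → N(0,1)([−|z|, |z|])` — THE POOLED INTERVAL IS
CALIBRATED (the law of the limit is `Scoring/GaussianCochranIndependence.pi_gaussianReal_pooled_preimage_eq`);
(iii) `k·V̂ₖ^pool → (Σ_r s_r⁻¹)⁻¹` a.s. (**`ae_tendsto_scaled_pooledErrorBar`**) and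
`(Σ_r s_r⁻¹)⁻¹ < s_r` for every `r` when `R ≥ 2` (**`inv_sum_inv_lt`**): asymptotically the pooled
error bar is STRICTLY SHORTER than every single code's.  The joint statement (i) is what
`Scoring/KArmPooledAfterHomogeneity` (conditional calibration given the test passes) consumes.

NOT CLAIMED: anything at finite `k`; dependent codes; unequal targets; numbers.
-/

open MeasureTheory ProbabilityTheory Filter Topology Finset

namespace Summit.Ventures.LatticeQCDFlow.Scoring

open Set WithLp

/-! ## §1 Algebra: the scale identity and the clamped pooled functional -/

section Algebra

variable {R : ℕ}

/-- **Scale identity for the pooled statistic**: for `n ≥ 1`, `v_r > 0`,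
`(m̂ − a)²·Σ_j v_j⁻¹ = (Σ_j √n(x_j − a)/(n v_j))²/(Σ_j (n v_j)⁻¹)`, `m̂ = (Σ_j x_j/v_j)/(Σ_j v_j⁻¹)`.
[ours] -/
theorem pooled_statistic_scale [NeZero R] {n : ℕ} (hn : 1 ≤ n) (x v : Fin R → ℝ)
    (hv : ∀ r, 0 < v r) (a : ℝ) :
    ((∑ j, x j / v j) / (∑ j, (v j)⁻¹) - a) ^ 2 * (∑ j, (v j)⁻¹)
      = (∑ j, Real.sqrt n * (x j - a) / ((n : ℝ) * v j)) ^ 2 / (∑ j, ((n : ℝ) * v j)⁻¹) := by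
  have hn0 : (0 : ℝ) < n := by exact_mod_cast hn
  set W := ∑ j, (v j)⁻¹ with hW
  have hW0 : 0 < W := Finset.sum_pos (fun j _ => inv_pos.2 (hv j)) Finset.univ_nonempty
  set T := ∑ j, x j / v j with hT
  have h1 : ∑ j, Real.sqrt n * (x j - a) / ((n : ℝ) * v j)
      = Real.sqrt n / n * (T - a * W) := by
    rw [hT, hW, mul_sub, Finset.mul_sum, Finset.mul_sum, Finset.mul_sum, ← Finset.sum_sub_distrib]
    refine Finset.sum_congr rfl fun j _ => ?_
    have := (hv j).ne'
    field_simp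
  have h2 : ∑ j, ((n : ℝ) * v j)⁻¹ = W / n := by
    rw [hW, Finset.sum_div]
    exact Finset.sum_congr rfl fun j _ => by have := (hv j).ne'; field_simp
  rw [h1, h2, mul_pow, div_pow, Real.sq_sqrt hn0.le]
  field_simp

/-- The clamped pooled functional `(Σ_j x_j/max(v_j, m₀))²/(Σ_j max(v_j, m₀)⁻¹)` is continuous on
`EuclideanSpace ℝ (Fin R) × EuclideanSpace ℝ (Fin R)` for every clamp `m₀ > 0`. [ours] -/
theorem continuous_pooledClamp [NeZero R] {m₀ : ℝ} (hm : 0 < m₀) :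
    Continuous fun p : EuclideanSpace ℝ (Fin R) × EuclideanSpace ℝ (Fin R) =>
      (∑ j, p.1 j / max (p.2 j) m₀) ^ 2 / (∑ j, (max (p.2 j) m₀)⁻¹) := by
  have hc1 : ∀ r : Fin R, Continuous fun p : EuclideanSpace ℝ (Fin R) × EuclideanSpace ℝ (Fin R) => p.1 r :=
    fun r => (PiLp.continuous_apply 2 _ r).comp continuous_fst
  have hc2 : ∀ r : Fin R, Continuous fun p : EuclideanSpace ℝ (Fin R) × EuclideanSpace ℝ (Fin R) =>
      max (p.2 r) m₀ :=
    fun r => ((PiLp.continuous_apply 2 _ r).comp continuous_snd).max continuous_const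
  have hpos : ∀ (p : EuclideanSpace ℝ (Fin R) × EuclideanSpace ℝ (Fin R)) (r : Fin R), 0 < max (p.2 r) m₀ :=
    fun p r => lt_max_of_lt_right hm
  have hden : Continuous fun p : EuclideanSpace ℝ (Fin R) × EuclideanSpace ℝ (Fin R) =>
      ∑ j, (max (p.2 j) m₀)⁻¹ :=
    continuous_finsetSum _ fun j _ => (hc2 j).inv₀ fun p => (hpos p j).ne'
  have hden0 : ∀ p : EuclideanSpace ℝ (Fin R) × EuclideanSpace ℝ (Fin R), (∑ j, (max (p.2 j) m₀)⁻¹) ≠ 0 :=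
    fun p => (Finset.sum_pos (fun j _ => inv_pos.2 (hpos p j)) Finset.univ_nonempty).ne'
  exact ((continuous_finsetSum _ fun j _ => (hc1 j).div (hc2 j) fun p => (hpos p j).ne').pow 2).div
    hden hden0

/-- **Pooling is strictly more precise than every single code**: `R ≥ 2`, `s_r > 0` ⇒
`(Σ_j s_j⁻¹)⁻¹ < s_r` for every `r` (the asymptotic pooled error bar is the shortest). [ours] -/
theorem inv_sum_inv_lt {n : ℕ} (s : Fin (n + 2) → ℝ) (hs : ∀ r, 0 < s r) (r : Fin (n + 2)) :
    (∑ j, (s j)⁻¹)⁻¹ < s r := by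
  obtain ⟨r', hr'⟩ : ∃ r' : Fin (n + 2), r' ≠ r := by
    by_cases h : r = 0
    · exact ⟨1, by rw [h]; exact one_ne_zero⟩
    · exact ⟨0, fun h0 => h h0.symm⟩
  have h1 : (s r)⁻¹ + (s r')⁻¹ ≤ ∑ j, (s j)⁻¹ := by
    rw [← Finset.sum_pair (f := fun j => (s j)⁻¹) hr'.symm]
    exact Finset.sum_le_sum_of_subset_of_nonneg (Finset.subset_univ _) fun j _ _ => (inv_pos.2 (hs j)).le
  have h4 : (s r)⁻¹ < ∑ j, (s j)⁻¹ := by linarith [inv_pos.2 (hs r')]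
  calc (∑ j, (s j)⁻¹)⁻¹ < ((s r)⁻¹)⁻¹ := inv_strictAnti₀ (inv_pos.2 (hs r)) h4
    _ = s r := inv_inv _

end Algebra

/-! ## §2 The joint limit theorem for the pair (pooled statistic, homogeneity statistic) -/

section Joint

variable {n : ℕ} {Ωs : Fin (n + 2) → Type*} [∀ r, MeasurableSpace (Ωs r)]
  {Ps : (r : Fin (n + 2)) → Measure (Ωs r)} [∀ r, IsProbabilityMeasure (Ps r)]
variable {Ω' : Type*} [MeasurableSpace Ω'] {P' : Measure Ω'} [IsProbabilityMeasure P']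

set_option maxHeartbeats 400000 in
/-- **THE POOLED STATISTIC AND THE HOMOGENEITY STATISTIC CONVERGE JOINTLY.**  `R = n + 2 ≥ 2`
codes, code `r` printing on its own probability space `Sₖ^r`, `V̂ₖ^r` (measurable) with
`√k(Sₖ^r − a) ⇒ Z_r` for some independent family of measurable real limits `(Z_r)` and
`k·V̂ₖ^r → s_r > 0` almost surely.  Then on `⊗_r P_r` the pair
`((m̂ₖ − a)²·Σ_r (V̂ₖ^r)⁻¹, Σ_r (Sₖ^r − m̂ₖ)²/V̂ₖ^r)`, `m̂ₖ = (Σ_r Sₖ^r/V̂ₖ^r)/(Σ_r (V̂ₖ^r)⁻¹)`, converges in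
distribution to `((Σ_r Z_r/s_r)²/(Σ_r s_r⁻¹), Σ_r (Z_r − m̂(Z))²/s_r)`. [ours] -/
theorem kArm_pooled_homogeneity_joint_tendsto {S V : (r : Fin (n + 2)) → ℕ → Ωs r → ℝ} {a : ℝ}
    {s : Fin (n + 2) → ℝ} {Z : Fin (n + 2) → Ω' → ℝ} (hs : ∀ r, 0 < s r)
    (hSm : ∀ r k, Measurable (S r k)) (hVm : ∀ r k, Measurable (V r k))
    (hclt : ∀ r, TendstoInDistribution (fun (k : ℕ) ω => Real.sqrt k * (S r k ω - a)) atTop (Z r)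
      (fun _ => Ps r) P')
    (hZm : ∀ r, Measurable (Z r)) (hind : iIndepFun Z P')
    (hV : ∀ r, ∀ᵐ ω ∂(Ps r), Tendsto (fun k : ℕ => (k : ℝ) * V r k ω) atTop (𝓝 (s r))) :
    TendstoInDistribution (fun (k : ℕ) (ω : (r : Fin (n + 2)) → Ωs r) =>
        (((∑ j, S j k (ω j) / V j k (ω j)) / (∑ j, (V j k (ω j))⁻¹) - a) ^ 2 * (∑ j, (V j k (ω j))⁻¹),
          ∑ r, (S r k (ω r) - (∑ j, S j k (ω j) / V j k (ω j)) / (∑ j, (V j k (ω j))⁻¹)) ^ 2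
            / V r k (ω r)))
      atTop (fun ω' => ((∑ j, Z j ω' / s j) ^ 2 / (∑ j, (s j)⁻¹),
        ∑ r, (Z r ω' - (∑ j, Z j ω' / s j) / (∑ j, (s j)⁻¹)) ^ 2 / s r))
      (fun _ => Measure.pi Ps) P' := by
  -- the clamp
  set m₀ : ℝ := (Finset.univ.inf' Finset.univ_nonempty s) / 2 with hm₀
  have hinf : 0 < Finset.univ.inf' Finset.univ_nonempty s :=
    (Finset.lt_inf'_iff _).2 fun r _ => hs r
  have hm0 : 0 < m₀ := by rw [hm₀]; exact half_pos hinf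
  have hm_le : ∀ r, m₀ < s r := fun r => by
    have : Finset.univ.inf' Finset.univ_nonempty s ≤ s r := Finset.inf'_le _ (Finset.mem_univ r)
    rw [hm₀]; linarith
  -- Step 1: joint convergence of the scaled columns and of the error-bar vector
  have hXm : ∀ r (k : ℕ), Measurable fun ω : Ωs r => Real.sqrt (k : ℝ) * (S r k ω - a) :=
    fun r k => ((hSm r k).sub_const a).const_mul _
  have hY := CardConsistency.tendstoInDistribution_replicas (Ps := Ps) hclt hXm hZm hind
  have hWm : ∀ k : ℕ, Measurable fun (ω : (r : Fin (n + 2)) → Ωs r) (r : Fin (n + 2)) =>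
      ((k : ℕ) : ℝ) * V r k (ω r) :=
    fun k => measurable_pi_lambda _ fun r => ((hVm r k).comp (measurable_pi_apply r)).const_mul _
  have hae : ∀ᵐ ω ∂(Measure.pi Ps), ∀ r, Tendsto (fun k : ℕ => (k : ℝ) * V r k (ω r)) atTop (𝓝 (s r)) := by
    rw [ae_all_iff]
    intro r
    exact (Measure.quasiMeasurePreserving_eval Ps r).ae (hV r)
  have hWm' : ∀ k : ℕ, Measurable fun (ω : (r : Fin (n + 2)) → Ωs r) =>
      (toLp 2 (fun r : Fin (n + 2) => ((k : ℕ) : ℝ) * V r k (ω r)) : EuclideanSpace ℝ (Fin (n + 2))) :=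
    fun k => (WithLp.measurable_toLp 2 _).comp (hWm k)
  have hW : TendstoInMeasure (Measure.pi Ps) (fun (k : ℕ) (ω : (r : Fin (n + 2)) → Ωs r) =>
      (toLp 2 (fun r : Fin (n + 2) => ((k : ℕ) : ℝ) * V r k (ω r)) : EuclideanSpace ℝ (Fin (n + 2))))
      atTop (fun _ => (toLp 2 s : EuclideanSpace ℝ (Fin (n + 2)))) := by
    refine tendstoInMeasure_of_tendsto_ae (fun k => (hWm' k).aestronglyMeasurable) ?_
    filter_upwards [hae] with ω hω
    exact ((PiLp.continuous_toLp 2 (fun _ : Fin (n + 2) => ℝ)).tendsto s).comp (tendsto_pi_nhds.2 hω)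
  -- Step 2: Slutsky with the clamped PAIR functional `H = (G, F)`
  set G : EuclideanSpace ℝ (Fin (n + 2)) × EuclideanSpace ℝ (Fin (n + 2)) → ℝ := fun p =>
    (∑ j, p.1 j / max (p.2 j) m₀) ^ 2 / (∑ j, (max (p.2 j) m₀)⁻¹) with hG
  set F : EuclideanSpace ℝ (Fin (n + 2)) × EuclideanSpace ℝ (Fin (n + 2)) → ℝ := fun p =>
    ∑ r, (p.1 r - (∑ j, p.1 j / max (p.2 j) m₀) / (∑ j, (max (p.2 j) m₀)⁻¹)) ^ 2 / max (p.2 r) m₀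
    with hF
  have hGc : Continuous G := continuous_pooledClamp (R := n + 2) hm0
  have hFc : Continuous F := continuous_homogeneityClamp (R := n + 2) hm0
  have hHc : Continuous fun p => (G p, F p) := hGc.prodMk hFc
  have hsl := hY.continuous_comp_prodMk_of_tendstoInMeasure_const hHc hW (fun k => (hWm' k).aemeasurable)
  -- the limit of the clamped pair is the unclamped pair of limit statistics
  have hlim : (fun ω' => (G ((toLp 2 fun r => Z r ω' : EuclideanSpace ℝ (Fin (n + 2))),
        (toLp 2 s : EuclideanSpace ℝ (Fin (n + 2)))),
        F ((toLp 2 fun r => Z r ω' : EuclideanSpace ℝ (Fin (n + 2))),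
        (toLp 2 s : EuclideanSpace ℝ (Fin (n + 2))))))
      = fun ω' => ((∑ j, Z j ω' / s j) ^ 2 / (∑ j, (s j)⁻¹),
        ∑ r, (Z r ω' - (∑ j, Z j ω' / s j) / (∑ j, (s j)⁻¹)) ^ 2 / s r) := by
    funext ω'
    simp only [hG, hF, max_eq_left (hm_le _).le]
  rw [hlim] at hsl
  -- Step 3: the printed pair agrees with the clamped pair eventually, almost surely
  have h1m : ∀ (k : ℕ) r, Measurable fun ω : (r : Fin (n + 2)) → Ωs r => S r k (ω r) :=
    fun k r => (hSm r k).comp (measurable_pi_apply r)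
  have h2m : ∀ (k : ℕ) r, Measurable fun ω : (r : Fin (n + 2)) → Ωs r => V r k (ω r) :=
    fun k r => (hVm r k).comp (measurable_pi_apply r)
  have hPm0 : ∀ k : ℕ, Measurable fun ω : (r : Fin (n + 2)) → Ωs r =>
      ((∑ j, S j k (ω j) / V j k (ω j)) / (∑ j, (V j k (ω j))⁻¹) - a) ^ 2 * (∑ j, (V j k (ω j))⁻¹) := by
    intro k
    have := h1m k
    have := h2m k
    fun_prop
  have hQm : ∀ k : ℕ, Measurable fun ω : (r : Fin (n + 2)) → Ωs r =>
      ∑ r, (S r k (ω r) - (∑ j, S j k (ω j) / V j k (ω j)) / (∑ j, (V j k (ω j))⁻¹)) ^ 2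
        / V r k (ω r) := by
    intro k
    have := h1m k
    have := h2m k
    fun_prop
  have hTm : ∀ k : ℕ, Measurable fun ω : (r : Fin (n + 2)) → Ωs r =>
      (((∑ j, S j k (ω j) / V j k (ω j)) / (∑ j, (V j k (ω j))⁻¹) - a) ^ 2 * (∑ j, (V j k (ω j))⁻¹),
        ∑ r, (S r k (ω r) - (∑ j, S j k (ω j) / V j k (ω j)) / (∑ j, (V j k (ω j))⁻¹)) ^ 2
          / V r k (ω r)) := fun k => (hPm0 k).prodMk (hQm k)
  have hPm : ∀ k : ℕ, Measurable fun ω : (r : Fin (n + 2)) → Ωs r =>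
      ((toLp 2 fun r => Real.sqrt (k : ℝ) * (S r k (ω r) - a) : EuclideanSpace ℝ (Fin (n + 2))),
        (toLp 2 (fun r : Fin (n + 2) => ((k : ℕ) : ℝ) * V r k (ω r)) : EuclideanSpace ℝ (Fin (n + 2)))) :=
    fun k => ((WithLp.measurable_toLp 2 _).comp (measurable_pi_lambda _ fun r =>
      (hXm r k).comp (measurable_pi_apply r))).prodMk (hWm' k)
  have hdev : TendstoInMeasure (Measure.pi Ps) ((fun (k : ℕ) (ω : (r : Fin (n + 2)) → Ωs r) =>
      (((∑ j, S j k (ω j) / V j k (ω j)) / (∑ j, (V j k (ω j))⁻¹) - a) ^ 2 * (∑ j, (V j k (ω j))⁻¹),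
        ∑ r, (S r k (ω r) - (∑ j, S j k (ω j) / V j k (ω j)) / (∑ j, (V j k (ω j))⁻¹)) ^ 2
          / V r k (ω r))) - fun (k : ℕ) ω =>
      (G ((toLp 2 fun r => Real.sqrt (k : ℝ) * (S r k (ω r) - a) : EuclideanSpace ℝ (Fin (n + 2))),
        (toLp 2 (fun r : Fin (n + 2) => ((k : ℕ) : ℝ) * V r k (ω r)) : EuclideanSpace ℝ (Fin (n + 2)))),
       F ((toLp 2 fun r => Real.sqrt (k : ℝ) * (S r k (ω r) - a) : EuclideanSpace ℝ (Fin (n + 2))),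
        (toLp 2 (fun r : Fin (n + 2) => ((k : ℕ) : ℝ) * V r k (ω r)) : EuclideanSpace ℝ (Fin (n + 2))))))
      atTop 0 := by
    refine tendstoInMeasure_of_tendsto_ae
      (fun k => ((hTm k).sub (hHc.measurable.comp (hPm k))).aestronglyMeasurable) ?_
    filter_upwards [hae] with ω hω
    have hev : ∀ᶠ k : ℕ in atTop, ∀ r, m₀ < ((k : ℕ) : ℝ) * V r k (ω r) :=
      eventually_all.2 fun r => (hω r).eventually_const_lt (hm_le r)
    refine (tendsto_const_nhds (x := (0 : ℝ × ℝ))).congr' ?_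
    filter_upwards [hev, eventually_ge_atTop 1] with k hk hk1
    have hVpos : ∀ r, 0 < V r k (ω r) := fun r => by
      have := hk r
      have hkpos : (0 : ℝ) < k := by exact_mod_cast hk1
      nlinarith [hm0]
    simp only [Pi.sub_apply, hG, hF, max_eq_left (hk _).le, Prod.mk_sub_mk]
    rw [homogeneity_statistic_scale hk1 (fun r => S r k (ω r)) (fun r => V r k (ω r)) hVpos a,
      pooled_statistic_scale hk1 (fun r => S r k (ω r)) (fun r => V r k (ω r)) hVpos a]
    simp [Prod.ext_iff]
  exact tendstoInDistribution_of_tendstoInMeasure_sub _ _ hsl hdev (fun k => (hTm k).aemeasurable)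

end Joint

/-! ## §3 The pooled interval: general limit and calibration under equal targets -/

section Pooled

variable {n : ℕ} {Ωs : Fin (n + 2) → Type*} [∀ r, MeasurableSpace (Ωs r)]
  {Ps : (r : Fin (n + 2)) → Measure (Ωs r)} [∀ r, IsProbabilityMeasure (Ps r)]
variable {Ω' : Type*} [MeasurableSpace Ω'] {P' : Measure Ω'} [IsProbabilityMeasure P']

/-- **THE GENERAL LIMIT THEOREM FOR THE POOLED INTERVAL.**  Same setting; if the limit statistic
`(Σ_r Z_r/s_r)²/(Σ_r s_r⁻¹)` has no atom at `z²`, then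
`P((m̂ₖ − a)²·Σ_r (V̂ₖ^r)⁻¹ ≤ z²) → P'((Σ_r Z_r/s_r)²/(Σ_r s_r⁻¹) ≤ z²)`. [ours] -/
theorem kArm_pooled_limit {S V : (r : Fin (n + 2)) → ℕ → Ωs r → ℝ} {a : ℝ}
    {s : Fin (n + 2) → ℝ} {Z : Fin (n + 2) → Ω' → ℝ} (hs : ∀ r, 0 < s r)
    (hSm : ∀ r k, Measurable (S r k)) (hVm : ∀ r k, Measurable (V r k))
    (hclt : ∀ r, TendstoInDistribution (fun (k : ℕ) ω => Real.sqrt k * (S r k ω - a)) atTop (Z r)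
      (fun _ => Ps r) P')
    (hZm : ∀ r, Measurable (Z r)) (hind : iIndepFun Z P')
    (hV : ∀ r, ∀ᵐ ω ∂(Ps r), Tendsto (fun k : ℕ => (k : ℝ) * V r k ω) atTop (𝓝 (s r))) {z : ℝ}
    (hatom : P' {ω' | (∑ j, Z j ω' / s j) ^ 2 / (∑ j, (s j)⁻¹) = z ^ 2} = 0) :
    Tendsto (fun k : ℕ => (Measure.pi Ps).real {ω : (r : Fin (n + 2)) → Ωs r |
        ((∑ j, S j k (ω j) / V j k (ω j)) / (∑ j, (V j k (ω j))⁻¹) - a) ^ 2 * (∑ j, (V j k (ω j))⁻¹)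
          ≤ z ^ 2})
      atTop (𝓝 (P'.real {ω' | (∑ j, Z j ω' / s j) ^ 2 / (∑ j, (s j)⁻¹) ≤ z ^ 2})) := by
  have hpair := kArm_pooled_homogeneity_joint_tendsto hs hSm hVm hclt hZm hind hV
  have hfst := hpair.continuous_comp continuous_fst
  have hLm : Measurable fun ω' => (∑ j, Z j ω' / s j) ^ 2 / (∑ j, (s j)⁻¹) := by fun_prop
  have hfr : (P'.map fun ω' => (∑ j, Z j ω' / s j) ^ 2 / (∑ j, (s j)⁻¹)) (frontier (Iic (z ^ 2))) = 0 := by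
    rw [frontier_Iic, Measure.map_apply hLm (measurableSet_singleton _)]
    exact hatom
  exact CardConsistency.tendsto_measureReal_preimage_of_tendstoInDistribution hfst
    measurableSet_Iic hfr

/-- **The law of the limit under equal targets**: independent `Z_r ∼ N(0, s_r)` (`s_r > 0`) ⇒ for
Borel `T`, `P'((Σ_r Z_r/s_r)/√(Σ_r s_r⁻¹) ∈ T) = N(0,1)(T)`. [ours] -/
theorem measure_pooled_limit_preimage_eq {Z : Fin (n + 2) → Ω' → ℝ} {s : Fin (n + 2) → ℝ}
    (hs : ∀ r, 0 < s r) (hZm : ∀ r, Measurable (Z r))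
    (hZ : ∀ r, HasLaw (Z r) (gaussianReal 0 (s r).toNNReal) P') (hind : iIndepFun Z P')
    {T : Set ℝ} (hT : MeasurableSet T) :
    P' {ω' | (∑ j, Z j ω' / s j) / Real.sqrt (∑ j, (s j)⁻¹) ∈ T} = gaussianReal 0 1 T := by
  have hlaw := hasLaw_standardise_pi hs hZm hZ hind
  set σ : Fin (n + 2) → ℝ := fun r => Real.sqrt (s r) with hσ
  have hσpos : ∀ r, 0 < σ r := fun r => Real.sqrt_pos.2 (hs r)
  have hσsq : ∀ r, σ r ^ 2 = s r := fun r => Real.sq_sqrt (hs r).le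
  set A : Set (Fin (n + 2) → ℝ) := {z | ((∑ j, (0 + σ j * z j) / σ j ^ 2) / (∑ j, (σ j ^ 2)⁻¹) - 0)
      * Real.sqrt (∑ j, (σ j ^ 2)⁻¹) ∈ T} with hA
  have hAm : MeasurableSet A := by
    simp only [hA]
    exact (by fun_prop : Measurable fun z : Fin (n + 2) → ℝ =>
      ((∑ j, (0 + σ j * z j) / σ j ^ 2) / (∑ j, (σ j ^ 2)⁻¹) - 0) * Real.sqrt (∑ j, (σ j ^ 2)⁻¹)) hT
  have hW : 0 < ∑ j, (s j)⁻¹ := Finset.sum_pos (fun j _ => inv_pos.2 (hs j)) Finset.univ_nonempty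
  have hpre : {ω' | (∑ j, Z j ω' / s j) / Real.sqrt (∑ j, (s j)⁻¹) ∈ T}
      = (fun ω' (r : Fin (n + 2)) => Z r ω' / Real.sqrt (s r)) ⁻¹' A := by
    ext ω'
    simp only [hA, Set.mem_setOf_eq, Set.mem_preimage, zero_add, sub_zero, hσsq]
    have hx : ∀ r, σ r * (Z r ω' / Real.sqrt (s r)) / s r = Z r ω' / s r := fun r => by
      have hsr : Real.sqrt (s r) ≠ 0 := (Real.sqrt_pos.2 (hs r)).ne'
      simp only [hσ]
      field_simp
    simp only [hx]
    have hsq : Real.sqrt (∑ j, (s j)⁻¹) ≠ 0 := (Real.sqrt_pos.2 hW).ne'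
    have e : (∑ j, Z j ω' / s j) / (∑ j, (s j)⁻¹) * Real.sqrt (∑ j, (s j)⁻¹)
        = (∑ j, Z j ω' / s j) / Real.sqrt (∑ j, (s j)⁻¹) := by
      rw [div_mul_eq_mul_div, div_eq_div_iff hW.ne' hsq, mul_assoc, Real.mul_self_sqrt hW.le]
    rw [e]
  rw [hpre, ← Measure.map_apply_of_aemeasurable hlaw.aemeasurable hAm, hlaw.map_eq, hA]
  exact pi_gaussianReal_pooled_preimage_eq 0 σ hσpos hT

/-- The squared form: `P'((Σ_r Z_r/s_r)²/(Σ_r s_r⁻¹) ∈ B) = N(0,1){t | t² ∈ B}`. [ours] -/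
theorem measure_pooled_limit_sq_preimage_eq {Z : Fin (n + 2) → Ω' → ℝ} {s : Fin (n + 2) → ℝ}
    (hs : ∀ r, 0 < s r) (hZm : ∀ r, Measurable (Z r))
    (hZ : ∀ r, HasLaw (Z r) (gaussianReal 0 (s r).toNNReal) P') (hind : iIndepFun Z P')
    {B : Set ℝ} (hB : MeasurableSet B) :
    P' {ω' | (∑ j, Z j ω' / s j) ^ 2 / (∑ j, (s j)⁻¹) ∈ B} = gaussianReal 0 1 {t | t ^ 2 ∈ B} := by
  have hW : 0 < ∑ j, (s j)⁻¹ := Finset.sum_pos (fun j _ => inv_pos.2 (hs j)) Finset.univ_nonempty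
  have hT : MeasurableSet {t : ℝ | t ^ 2 ∈ B} := (by fun_prop : Measurable fun t : ℝ => t ^ 2) hB
  have h := measure_pooled_limit_preimage_eq hs hZm hZ hind hT
  have e : {ω' | (∑ j, Z j ω' / s j) / Real.sqrt (∑ j, (s j)⁻¹) ∈ {t : ℝ | t ^ 2 ∈ B}}
      = {ω' | (∑ j, Z j ω' / s j) ^ 2 / (∑ j, (s j)⁻¹) ∈ B} := by
    ext ω'
    simp only [Set.mem_setOf_eq, div_pow, Real.sq_sqrt hW.le]
  rw [e] at h
  exact h

/-- `{t | t² ≤ z²} = [−|z|, |z|]`. -/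
theorem setOf_sq_le_sq_eq_Icc (z : ℝ) : {t : ℝ | t ^ 2 ≤ z ^ 2} = Icc (-|z|) |z| := by
  ext t
  simp only [Set.mem_setOf_eq, Set.mem_Icc, sq_le_sq, abs_le]

/-- **THE POOLED INTERVAL IS CALIBRATED.**  `R = n + 2 ≥ 2` codes with the SAME target `a`,
`√k(Sₖ^r − a) ⇒ N(0, s_r)` (`s_r > 0`), `k·V̂ₖ^r → s_r` a.s., independent limits: for every `z`,
`P((m̂ₖ − a)²·Σ_r (V̂ₖ^r)⁻¹ ≤ z²) → N(0,1)([−|z|, |z|])` — i.e. "`|m̂ₖ − a| ≤ z·√V̂ₖ^pool`" with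
`V̂ₖ^pool = (Σ_r (V̂ₖ^r)⁻¹)⁻¹` has the nominal two-sided Gaussian probability asymptotically. [ours] -/
theorem kArm_pooled_coverage {S V : (r : Fin (n + 2)) → ℕ → Ωs r → ℝ} {a : ℝ}
    {s : Fin (n + 2) → ℝ} {Z : Fin (n + 2) → Ω' → ℝ} (hs : ∀ r, 0 < s r)
    (hSm : ∀ r k, Measurable (S r k)) (hVm : ∀ r k, Measurable (V r k))
    (hclt : ∀ r, TendstoInDistribution (fun (k : ℕ) ω => Real.sqrt k * (S r k ω - a)) atTop (Z r)
      (fun _ => Ps r) P')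
    (hZm : ∀ r, Measurable (Z r)) (hZ : ∀ r, HasLaw (Z r) (gaussianReal 0 (s r).toNNReal) P')
    (hind : iIndepFun Z P')
    (hV : ∀ r, ∀ᵐ ω ∂(Ps r), Tendsto (fun k : ℕ => (k : ℝ) * V r k ω) atTop (𝓝 (s r))) (z : ℝ) :
    Tendsto (fun k : ℕ => (Measure.pi Ps).real {ω : (r : Fin (n + 2)) → Ωs r |
        ((∑ j, S j k (ω j) / V j k (ω j)) / (∑ j, (V j k (ω j))⁻¹) - a) ^ 2 * (∑ j, (V j k (ω j))⁻¹)
          ≤ z ^ 2})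
      atTop (𝓝 ((gaussianReal 0 1).real (Icc (-|z|) |z|))) := by
  have hatom : P' {ω' | (∑ j, Z j ω' / s j) ^ 2 / (∑ j, (s j)⁻¹) = z ^ 2} = 0 := by
    have h := measure_pooled_limit_sq_preimage_eq hs hZm hZ hind (measurableSet_singleton (z ^ 2))
    simp only [Set.mem_singleton_iff] at h
    rw [h]
    have hsub : {t : ℝ | t ^ 2 = z ^ 2} ⊆ {z, -z} := by
      intro t ht
      simp only [Set.mem_setOf_eq] at ht
      rcases sq_eq_sq_iff_eq_or_eq_neg.1 ht with h1 | h1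
      · simp [h1]
      · simp [h1]
    exact measure_mono_null hsub (by
      haveI := nullSingletonClass_gaussianReal (μ := 0) one_ne_zero
      exact (Set.toFinite _).measure_zero _)
  have hconv := kArm_pooled_limit hs hSm hVm hclt hZm hind hV hatom
  have hlimit : P'.real {ω' | (∑ j, Z j ω' / s j) ^ 2 / (∑ j, (s j)⁻¹) ≤ z ^ 2}
      = (gaussianReal 0 1).real (Icc (-|z|) |z|) := by
    simp only [measureReal_def]
    congr 1
    have h := measure_pooled_limit_sq_preimage_eq hs hZm hZ hind (measurableSet_Iic (a := z ^ 2))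
    simp only [Set.mem_Iic] at h
    rw [h, setOf_sq_le_sq_eq_Icc]
  rw [hlimit] at hconv
  exact hconv

/-- **The pooled error bar**: `k·V̂ₖ^r → s_r` for every `r` almost surely ⇒
`k·(Σ_r (V̂ₖ^r)⁻¹)⁻¹ → (Σ_r s_r⁻¹)⁻¹` almost surely on the product space (`s_r > 0`). [ours] -/
theorem ae_tendsto_scaled_pooledErrorBar {V : (r : Fin (n + 2)) → ℕ → Ωs r → ℝ}
    {s : Fin (n + 2) → ℝ} (hs : ∀ r, 0 < s r)
    (hV : ∀ r, ∀ᵐ ω ∂(Ps r), Tendsto (fun k : ℕ => (k : ℝ) * V r k ω) atTop (𝓝 (s r))) :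
    ∀ᵐ ω ∂(Measure.pi Ps), Tendsto (fun k : ℕ => (k : ℝ) * (∑ j, (V j k (ω j))⁻¹)⁻¹) atTop
      (𝓝 (∑ j, (s j)⁻¹)⁻¹) := by
  have hae : ∀ᵐ ω ∂(Measure.pi Ps), ∀ r, Tendsto (fun k : ℕ => (k : ℝ) * V r k (ω r)) atTop (𝓝 (s r)) := by
    rw [ae_all_iff]
    intro r
    exact (Measure.quasiMeasurePreserving_eval Ps r).ae (hV r)
  have hW : 0 < ∑ j, (s j)⁻¹ := Finset.sum_pos (fun j _ => inv_pos.2 (hs j)) Finset.univ_nonempty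
  filter_upwards [hae] with ω hω
  have h1 : Tendsto (fun k : ℕ => ∑ j, (((k : ℕ) : ℝ) * V j k (ω j))⁻¹) atTop (𝓝 (∑ j, (s j)⁻¹)) :=
    tendsto_finsetSum _ fun j _ => (hω j).inv₀ (hs j).ne'
  have h2 := h1.inv₀ hW.ne'
  refine h2.congr' ?_
  filter_upwards [eventually_ge_atTop 1] with k hk1
  have hk : (k : ℝ) ≠ 0 := by exact_mod_cast (Nat.one_le_iff_ne_zero.1 hk1)
  have e : ∑ j, (((k : ℕ) : ℝ) * V j k (ω j))⁻¹ = (k : ℝ)⁻¹ * ∑ j, (V j k (ω j))⁻¹ := by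
    rw [Finset.mul_sum]
    refine Finset.sum_congr rfl fun j _ => ?_
    rw [mul_inv]
  rw [e, mul_inv, inv_inv]

end Pooled

end Summit.Ventures.LatticeQCDFlow.Scoring
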